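/-
Copyright (c) 2026 the pub-hodgecm-mathlib formalisation cell (harness21).  Prover seat hodgecm-mathlib-K2E2-p12 (g5): Track B «K2-LIT», ENGINE E1,
h413 = stmt-HodgeConjecture-24833; «EIS-WHITTAKER-3» ∕ W5₃ (L3): deal (57)(ii) of K2E1-plan (g6) «(L3-bad) BAD-PLACE LOCAL FACTOR TO σ > 1», part (A): non-split bad places.
-/
import Summits.HodgeConjecture.HodgeConjecture.Theorems.K2E1IntertwiningLocalHeightU3            -- ★ (this seat) (3-iii-a): `continuous_localHeight_rpow`; brings ★ (3-i) `integrable_inertCell_pi`, ★ `quadraticLocalEquiv_mul_conjLocal`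
import Summits.HodgeConjecture.HodgeConjecture.Theorems.K2E3U2DiscrInvFourthRootLocallyIntegrable -- ★ (K2E5-p12 g2): `normAbs_toPlace_eq_sq` — `|ι y|_w = |y|_v²` at ANY non-split place
import Literature.NumberTheory.Automorphic.HeisenbergChartAtNonsplitPlace                      -- ★ `valued_conjLocal_apply_of_smul_eq` (`σ_w` is an isometry)
import Literature.NumberTheory.Automorphic.TateLocalZetaShells                                  -- ★ `isCompact_primePowBall`
import Literature.NumberTheory.Automorphic.AddCharConductorExponent                            -- ★ `normAbs_le_normAbs_iff_valued`
import HarnessLib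

/-!
# K2·E1 — `K2E1IntertwiningLocalFactorBadPlaceU3` (deal (57)(ii) «(L3-bad)», part (A)): AT EVERY NON-SPLIT PLACE `v` OF `L⁺` — ramified, `v ∣ 2`, `δ` a non-unit allowed — the local
# height `Q_v` of the `U(2,1)` intertwining∕Whittaker integrals DOMINATES the model weight, `Q_v(p) ≥ c_v·𝒲(p)²`, hence `Q_v^{−σ}` is integrable for every real `σ > 1`

Track B ∕ K2-LIT, crux h413 = `stmt-HodgeConjecture-24833`, route of record `HCCMUnconditional`; cell `hodgecm-mathlib`, squad K2, ENGINE E1 (W5₃ (L3): the bad-place local factors of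
the spherical constant term ∕ F3's letter `hT` at abscissa `σ > 1`).  THEOREMS ONLY (no `def`, no instance, no notation, no `sorry`; default heartbeats); lane
`--supports stmt-HodgeConjecture-24833 --as helper` (count-neutral).  `Q_v(p) = max(1, ‖Ψ_v(p₀,p₁)_w‖_w, ‖(ι(p₂)δ − ½Ψ_vσΨ_v)_w‖_w)` (one place `w ∣ v`), `𝒲(p) = max(1, max(|p₀|,|p₁|)², |p₂|)`
(★ (3-i)'s weight).  At a GOOD inert place `Q_v = 𝒲²` exactly (★ `max_one_norm_height_eq_sq`); here, with NO arithmetic hypothesis on `v`, the two-sided structure survives as an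
inequality with a constant: NORM EQUIVALENCE on the `L⁺_v`-plane `L_w = ι(L⁺_v) ⊕ ι(L⁺_v)·δ_w` (compactness of the unit sphere `max(|a|,|b|) = 1`, scaling by ★ `normAbs_toPlace_eq_sq`
`|ι λ|_w = |λ|_v²`), the corner `= Ψ_v(−N∕2, p₂)` with `N = p₀² − d p₁²` (★ norm form), `|N|_v ≥ c·max(|p₀|,|p₁|)²` (`σ_w` isometry ★), whence `Q_v ≥ c'·𝒲²` and
`Q_v^{−σ} ≤ c'^{−σ}·𝒲^{−2σ}` ★ `integrable_inertCell_pi` (abstract local field, `σ > 1`).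
* §1 `exists_pos_mul_sq_le_normAbs_quadraticLocalEquiv` (norm equivalence, lower half).  §2 `corner_eq_quadraticLocalEquiv`, `mul_sq_le_normAbs_norm`.  §3 `exists_pos_mul_weight_sq_le_localHeight`.
* §4 **`integrable_localHeight_rpow_neg_of_nonsplit (hw : c•w = w) (hσ : 1 < σ)`** (HEAD): `Integrable (p ↦ Q_v(p)^{−σ}) (Measure.pi fun _ => νv)` — F3's letter `hT` ∕ (β)'s «every-v
  integrability» at a non-split bad place, abscissa `σ > 1` (part (B), split bad places, is the sibling file).
HONEST LABEL: HC_CM is proved only modulo the 7 printed citations (2 remaining named inputs: hLiu418 = `stmt-HodgeConjecture-24832`, h413 = `stmt-HodgeConjecture-24833`) until rung 0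
closes; this file asserts no named fact and closes no socket; count-neutral; unconditional.

## References
* [Langlands1971] R. P. Langlands, *Euler Products* (1971): §3 (local intertwining integrals).
* [TateThesis1967] J. Tate, *Fourier analysis in number fields and Hecke's zeta-functions* (1967): §2.2, §3.3.
* [CasselsFrohlichANT1967] J. W. S. Cassels, A. Fröhlich (eds.), *Algebraic Number Theory* (1967): Ch. II §8, §10 (equivalence of norms over a local field).
-/

set_option autoImplicit false
set_option linter.dupNamespace false -- the mandated namespace repeats `HodgeConjecture.HodgeConjecture`

noncomputable section

open MeasureTheory NumberField IsDedekindDomain Filter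
open scoped NNReal
open Literature.NumberTheory.Automorphic Literature.NumberTheory.Automorphic.UnitaryGroup Literature.NumberTheory.GaloisRepresentations
open Literature.NumberTheory.GaloisRepresentations.IsNonarchimedeanLocalField
open Literature.NumberTheory.Automorphic.LocalFieldHaar (continuous_normAbs)
open Summit.HodgeConjecture.HodgeConjecture.Cruxes.H413.K2E1IntertwiningLocalFactorU3Height (quadraticLocalEquiv_mul_conjLocal ne_one_of_apply_eq_neg)
open Summit.HodgeConjecture.HodgeConjecture.Cruxes.H413.K2E1IntertwiningLocalHeightU3 (continuous_localHeight_rpow)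
open Summit.HodgeConjecture.HodgeConjecture.Cruxes.H413.K2E1IntertwiningLocalMeanInertU3 (integrable_inertCell_pi)
open Summit.HodgeConjecture.HodgeConjecture.Cruxes.H413.K2E3U2DiscrInvFourthRootLocallyIntegrable (normAbs_toPlace_eq_sq)

namespace Summit.HodgeConjecture.HodgeConjecture.Cruxes.H413.K2E1IntertwiningLocalFactorBadPlaceU3

variable (L : Type) [Field L] [NumberField L] [IsCMField L] {δ : L} (hcδ : IsCMField.complexConj L δ = -δ) (hδ : δ ≠ 0)
  {d : ↥(maximalRealSubfield L)} (hd : δ * δ = algebraMap ↥(maximalRealSubfield L) L d) (v : HeightOneSpectrum (𝓞 ↥(maximalRealSubfield L))) (w : PlacesOver L v)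

/-! ## §1 Norm equivalence on `L_w = ι(L⁺_v) ⊕ ι(L⁺_v)·δ_w` (lower half) -/

include hcδ hδ in
/-- **`c·max(|a|,|b|)² ≤ ‖Ψ_v(a,b)_w‖_w` FOR SOME `c > 0`** at a non-split place `w` (no arithmetic hypothesis on `v`): the continuous function `(a,b) ↦ ‖Ψ_v(a,b)_w‖_w` is positive on the
compact unit sphere `max(|a|,|b|) = 1` (injectivity of `Ψ_v`, one place above `v`), hence bounded below by some `c > 0` there; a general `(a,b) ≠ 0` is `λ·(a',b')` with `|λ| = max(|a|,|b|)`,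
`(a',b')` on the sphere, and `‖ι λ‖_w = |λ|_v²` ★. [cite: CasselsFrohlichANT1967, Ch. II §8] -/
theorem exists_pos_mul_sq_le_normAbs_quadraticLocalEquiv (hw : IsCMField.complexConj L • w.1 = w.1) :
    ∃ c₀ : ℝ, 0 < c₀ ∧ ∀ a b : v.adicCompletion ↥(maximalRealSubfield L),
      c₀ * (max ((normAbs (v.adicCompletion ↥(maximalRealSubfield L)) (a) : ℝ≥0) : ℝ) ((normAbs (v.adicCompletion ↥(maximalRealSubfield L)) (b) : ℝ≥0) : ℝ)) ^ 2 ≤ ((normAbs (w.1.adicCompletion L) (quadraticLocalEquiv L v (IsCMField.complexConj L) hcδ hδ (a, b) w) : ℝ≥0) : ℝ) := by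
  haveI : Algebra.IsQuadraticExtension ↥(maximalRealSubfield L) L := IsCMField.isQuadraticExtension L
  haveI : Subsingleton (PlacesOver L v) := PlacesOver.subsingleton_of_smul_eq (IsCMField.complexConj L) (ne_one_of_apply_eq_neg L (IsCMField.complexConj L) hcδ hδ) w hw
  -- the continuous function and the compact sphere
  set f : v.adicCompletion ↥(maximalRealSubfield L) × v.adicCompletion ↥(maximalRealSubfield L) → ℝ := fun p => ((normAbs (w.1.adicCompletion L) (quadraticLocalEquiv L v (IsCMField.complexConj L) hcδ hδ p w) : ℝ≥0) : ℝ) with hf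
  have hfc : Continuous f := NNReal.continuous_coe.comp (continuous_normAbs.comp
    ((continuous_apply w).comp (quadraticLocalEquiv L v (IsCMField.complexConj L) hcδ hδ).continuous))
  set S : Set (v.adicCompletion ↥(maximalRealSubfield L) × v.adicCompletion ↥(maximalRealSubfield L)) := {p | max (normAbs (v.adicCompletion ↥(maximalRealSubfield L)) p.1) (normAbs (v.adicCompletion ↥(maximalRealSubfield L)) p.2) = 1} with hS
  have hSc : IsCompact S := by
    have hsub : S ⊆ primePowBall (v.adicCompletion ↥(maximalRealSubfield L)) 0 ×ˢ primePowBall (v.adicCompletion ↥(maximalRealSubfield L)) 0 := fun p hp => by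
      simp only [hS, Set.mem_setOf_eq] at hp
      refine Set.mk_mem_prod ?_ ?_ <;> rw [mem_primePowBall_iff, zpow_zero]
      · exact hp ▸ le_max_left _ _
      · exact hp ▸ le_max_right _ _
    refine ((isCompact_primePowBall 0).prod (isCompact_primePowBall 0)).of_isClosed_subset ?_ hsub
    exact isClosed_eq ((continuous_normAbs.comp continuous_fst).max (continuous_normAbs.comp continuous_snd)) continuous_const
  have hSne : S.Nonempty := ⟨(1, 0), by simp [hS]⟩
  obtain ⟨p₀, hp₀S, hmin⟩ := hSc.exists_isMinOn hSne hfc.continuousOn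
  -- positivity at the minimum
  have hp₀ne : p₀ ≠ 0 := by
    rintro rfl
    simp [hS] at hp₀S
  have hfp₀ : 0 < f p₀ := by
    have hne : quadraticLocalEquiv L v (IsCMField.complexConj L) hcδ hδ p₀ w ≠ 0 := by
      intro h0
      apply hp₀ne
      have hall : quadraticLocalEquiv L v (IsCMField.complexConj L) hcδ hδ p₀ = 0 := funext fun w' => by rw [Subsingleton.elim w' w, h0]; rfl
      exact (map_eq_zero_iff _ (quadraticLocalEquiv L v (IsCMField.complexConj L) hcδ hδ).injective).1 hall
    have : normAbs (w.1.adicCompletion L) (quadraticLocalEquiv L v (IsCMField.complexConj L) hcδ hδ p₀ w) ≠ 0 := fun h => hne ((map_eq_zero _).1 h)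
    exact NNReal.coe_pos.2 (pos_iff_ne_zero.2 this)
  refine ⟨f p₀, hfp₀, fun a b => ?_⟩
  -- the trivial case
  by_cases hab : a = 0 ∧ b = 0
  · obtain ⟨rfl, rfl⟩ := hab
    simp
  -- scaling: `λ ∈ {a, b}` of maximal absolute value
  obtain ⟨lam, hlam, hlamax⟩ : ∃ lam : v.adicCompletion ↥(maximalRealSubfield L), lam ≠ 0 ∧ normAbs (v.adicCompletion ↥(maximalRealSubfield L)) lam = max (normAbs (v.adicCompletion ↥(maximalRealSubfield L)) a) (normAbs (v.adicCompletion ↥(maximalRealSubfield L)) b) := by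
    by_cases hle : normAbs (v.adicCompletion ↥(maximalRealSubfield L)) b ≤ normAbs (v.adicCompletion ↥(maximalRealSubfield L)) a
    · refine ⟨a, fun ha => ?_, (max_eq_left hle).symm⟩
      rw [ha, map_zero, nonpos_iff_eq_zero, map_eq_zero] at hle
      exact hab ⟨ha, hle⟩
    · exact ⟨b, fun hb => by rw [hb, map_zero] at hle; exact hle bot_le, (max_eq_right (not_le.1 hle).le).symm⟩
  have hlampos : 0 < normAbs (v.adicCompletion ↥(maximalRealSubfield L)) lam := pos_iff_ne_zero.2 ((map_ne_zero _).2 hlam)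
  have hmemS : (a / lam, b / lam) ∈ S := by
    simp only [hS, Set.mem_setOf_eq, map_div₀]
    rw [max_div_div_right zero_le, ← hlamax, div_self hlampos.ne']
  have hle := hmin hmemS
  rw [Set.mem_setOf_eq] at hle
  -- `Ψ(a,b)_w = ι(λ)·Ψ(a/λ, b/λ)_w`
  have ha : lam * (a / lam) = a := by field_simp
  have hb : lam * (b / lam) = b := by field_simp
  have hfac : quadraticLocalEquiv L v (IsCMField.complexConj L) hcδ hδ (a, b) w = toPlace v w lam * quadraticLocalEquiv L v (IsCMField.complexConj L) hcδ hδ (a / lam, b / lam) w := by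
    have hprod : quadraticLocalEquiv L v (IsCMField.complexConj L) hcδ hδ (lam * (a / lam), lam * (b / lam)) =
        toLocalRing L v lam * quadraticLocalEquiv L v (IsCMField.complexConj L) hcδ hδ (a / lam, b / lam) := by
      rw [quadraticLocalEquiv_apply, quadraticLocalEquiv_apply]
      simp only [map_mul]
      ring
    rw [← toLocalRing_apply L v lam w, ← Pi.mul_apply, ← hprod, ha, hb]
  rw [hfac, map_mul, normAbs_toPlace_eq_sq L v w hw lam, hlamax]
  push_cast
  rw [mul_comm]
  exact mul_le_mul_of_nonneg_left hle (sq_nonneg _)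

/-! ## §2 The corner in quadratic coordinates, and the norm `N = p₀² − d p₁²` -/

include hd in
/-- **THE CORNER IS `Ψ_v(−N∕2, p₂)`**, `N = p₀² − d p₁²`: `ι(p₂)δ − ½·Ψ_v(p₀,p₁)·σΨ_v(p₀,p₁) = Ψ_v(−2⁻¹N, p₂)` (★ norm form `Ψ·σΨ = ι(N)`; any place). [cite: Langlands1971, §3] -/
theorem corner_eq_quadraticLocalEquiv (p₀ p₁ p₂ : v.adicCompletion ↥(maximalRealSubfield L)) :
    toLocalRing L v p₂ * algebraMap L (LocalRing L v) δ -
        toLocalRing L v 2⁻¹ * (quadraticLocalEquiv L v (IsCMField.complexConj L) hcδ hδ (p₀, p₁) * conjLocal L (IsCMField.complexConj L) v (quadraticLocalEquiv L v (IsCMField.complexConj L) hcδ hδ (p₀, p₁))) =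
      quadraticLocalEquiv L v (IsCMField.complexConj L) hcδ hδ (-(2⁻¹ * (p₀ ^ 2 - (d : v.adicCompletion ↥(maximalRealSubfield L)) * p₁ ^ 2)), p₂) := by
  haveI : Algebra.IsQuadraticExtension ↥(maximalRealSubfield L) L := IsCMField.isQuadraticExtension L
  rw [quadraticLocalEquiv_mul_conjLocal L (IsCMField.complexConj L) hcδ hδ hd v p₀ p₁, quadraticLocalEquiv_apply]
  simp only [map_neg, map_mul]
  ring

include hd in
/-- **`|N|_v = ‖Ψ_v(p₀,p₁)_w‖_w`** at a non-split place (`N = p₀² − d p₁²`): `ι(N) = Ψ·σΨ` ★, `‖σX‖_w = ‖X‖_w` ★, `‖ι N‖_w = |N|_v²` ★. [cite: CasselsFrohlichANT1967, Ch. II §10] -/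
theorem normAbs_norm_eq (hw : IsCMField.complexConj L • w.1 = w.1) (p₀ p₁ : v.adicCompletion ↥(maximalRealSubfield L)) :
    normAbs (v.adicCompletion ↥(maximalRealSubfield L)) (p₀ ^ 2 - (d : v.adicCompletion ↥(maximalRealSubfield L)) * p₁ ^ 2) = normAbs (w.1.adicCompletion L) (quadraticLocalEquiv L v (IsCMField.complexConj L) hcδ hδ (p₀, p₁) w) := by
  haveI : Algebra.IsQuadraticExtension ↥(maximalRealSubfield L) L := IsCMField.isQuadraticExtension L
  have hconj : normAbs (w.1.adicCompletion L) (conjLocal L (IsCMField.complexConj L) v (quadraticLocalEquiv L v (IsCMField.complexConj L) hcδ hδ (p₀, p₁)) w) =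
      normAbs (w.1.adicCompletion L) (quadraticLocalEquiv L v (IsCMField.complexConj L) hcδ hδ (p₀, p₁) w) :=
    le_antisymm ((normAbs_le_normAbs_iff_valued _ _ _).2 (valued_conjLocal_apply_of_smul_eq L v w hw _).le)
      ((normAbs_le_normAbs_iff_valued _ _ _).2 (valued_conjLocal_apply_of_smul_eq L v w hw _).ge)
  have h := congrArg (fun X : LocalRing L v => normAbs (w.1.adicCompletion L) (X w)) (quadraticLocalEquiv_mul_conjLocal L (IsCMField.complexConj L) hcδ hδ hd v p₀ p₁)
  simp only [Pi.mul_apply, map_mul, hconj, toLocalRing_apply, normAbs_toPlace_eq_sq L v w hw, ← sq] at h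
  have h' := congrArg NNReal.sqrt h
  simpa only [NNReal.sqrt_sq] using h'.symm

/-! ## §3 `Q_v ≥ c'·𝒲²` -/

include hd in
/-- **THE LOCAL HEIGHT DOMINATES THE MODEL WEIGHT**: at a non-split place there is `c' > 0` with `c'·𝒲(p)² ≤ Q_v(p)` for all `p`, `𝒲(p) = max(1, max(|p₀|,|p₁|)², |p₂|)` (§1 on
`Ψ_v(p₀,p₁)` and on the corner `Ψ_v(−N∕2, p₂)`, `|N| = ‖Ψ_v(p₀,p₁)_w‖`). [cite: Langlands1971, §3] [cite: CasselsFrohlichANT1967, Ch. II §8] -/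
theorem exists_pos_mul_weight_sq_le_localHeight (hw : IsCMField.complexConj L • w.1 = w.1) :
    ∃ c' : ℝ, 0 < c' ∧ ∀ p : Fin 3 → v.adicCompletion ↥(maximalRealSubfield L),
      c' * (max 1 (max ((max ((normAbs (v.adicCompletion ↥(maximalRealSubfield L)) (p 0) : ℝ≥0) : ℝ) ((normAbs (v.adicCompletion ↥(maximalRealSubfield L)) (p 1) : ℝ≥0) : ℝ)) ^ 2) ((normAbs (v.adicCompletion ↥(maximalRealSubfield L)) (p 2) : ℝ≥0) : ℝ))) ^ 2 ≤
        (∏ w' : PlacesOver L v, max 1 (max ((normAbs (w'.1.adicCompletion L) (quadraticLocalEquiv L v (IsCMField.complexConj L) hcδ hδ (p 0, p 1) w') : ℝ≥0) : ℝ)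
          ((normAbs (w'.1.adicCompletion L) ((toLocalRing L v (p 2) * algebraMap L (LocalRing L v) δ -
            toLocalRing L v 2⁻¹ * (quadraticLocalEquiv L v (IsCMField.complexConj L) hcδ hδ (p 0, p 1) *
              conjLocal L (IsCMField.complexConj L) v (quadraticLocalEquiv L v (IsCMField.complexConj L) hcδ hδ (p 0, p 1)))) w') : ℝ≥0) : ℝ))) := by
  haveI : Algebra.IsQuadraticExtension ↥(maximalRealSubfield L) L := IsCMField.isQuadraticExtension L
  haveI : Subsingleton (PlacesOver L v) := PlacesOver.subsingleton_of_smul_eq (IsCMField.complexConj L) (ne_one_of_apply_eq_neg L (IsCMField.complexConj L) hcδ hδ) w hw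
  obtain ⟨c₀, hc₀, hle⟩ := exists_pos_mul_sq_le_normAbs_quadraticLocalEquiv L hcδ hδ v w hw
  set t₂ : ℝ := ((normAbs (v.adicCompletion ↥(maximalRealSubfield L)) ((2⁻¹ : v.adicCompletion ↥(maximalRealSubfield L))) : ℝ≥0) : ℝ) with ht₂
  have ht₂pos : 0 < t₂ := NNReal.coe_pos.2 (pos_iff_ne_zero.2 ((map_ne_zero _).2 (inv_ne_zero two_ne_zero)))
  set k : ℝ := min (t₂ * c₀) 1 with hk
  have hkpos : 0 < k := lt_min (mul_pos ht₂pos hc₀) one_pos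
  have hk1 : k ≤ 1 := min_le_right _ _
  refine ⟨min 1 (c₀ * k ^ 2), lt_min one_pos (mul_pos hc₀ (pow_pos hkpos 2)), fun p => ?_⟩
  rw [Fintype.prod_subsingleton _ w, corner_eq_quadraticLocalEquiv L hcδ hδ hd v (p 0) (p 1) (p 2)]
  -- the two coordinates of `Q_v`
  set A : ℝ := ((normAbs (w.1.adicCompletion L) (quadraticLocalEquiv L v (IsCMField.complexConj L) hcδ hδ (p 0, p 1) w) : ℝ≥0) : ℝ) with hA
  set B : ℝ := ((normAbs (w.1.adicCompletion L) (quadraticLocalEquiv L v (IsCMField.complexConj L) hcδ hδ (-(2⁻¹ * (p 0 ^ 2 - (d : v.adicCompletion ↥(maximalRealSubfield L)) * p 1 ^ 2)), p 2) w) : ℝ≥0) : ℝ) with hB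
  set M : ℝ := max ((normAbs (v.adicCompletion ↥(maximalRealSubfield L)) (p 0) : ℝ≥0) : ℝ) ((normAbs (v.adicCompletion ↥(maximalRealSubfield L)) (p 1) : ℝ≥0) : ℝ) with hM
  set m : ℝ := max (M ^ 2) ((normAbs (v.adicCompletion ↥(maximalRealSubfield L)) (p 2) : ℝ≥0) : ℝ) with hm
  have hM0 : 0 ≤ M := le_max_of_le_left (NNReal.coe_nonneg _)
  have hm0 : 0 ≤ m := le_max_of_le_left (sq_nonneg _)
  have hAM : c₀ * M ^ 2 ≤ A := hle (p 0) (p 1)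
  have hN : ((normAbs (v.adicCompletion ↥(maximalRealSubfield L)) (2⁻¹ * (p 0 ^ 2 - (d : v.adicCompletion ↥(maximalRealSubfield L)) * p 1 ^ 2)) : ℝ≥0) : ℝ) = t₂ * A := by
    rw [map_mul, NNReal.coe_mul, normAbs_norm_eq L hcδ hδ hd v w hw (p 0) (p 1)]
  have hBle : c₀ * (max ((normAbs (v.adicCompletion ↥(maximalRealSubfield L)) (-(2⁻¹ * (p 0 ^ 2 - (d : v.adicCompletion ↥(maximalRealSubfield L)) * p 1 ^ 2))) : ℝ≥0) : ℝ) ((normAbs (v.adicCompletion ↥(maximalRealSubfield L)) (p 2) : ℝ≥0) : ℝ)) ^ 2 ≤ B := hle _ _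
  rw [normAbs_neg, hN] at hBle
  -- `max(t₂ A, |p₂|) ≥ k·m`
  have hkm : k * m ≤ max (t₂ * A) ((normAbs (v.adicCompletion ↥(maximalRealSubfield L)) (p 2) : ℝ≥0) : ℝ) := by
    rw [hm, mul_max_of_nonneg _ _ hkpos.le]
    refine max_le_max ?_ ?_
    · calc k * M ^ 2 ≤ t₂ * c₀ * M ^ 2 := mul_le_mul_of_nonneg_right (min_le_left _ _) (sq_nonneg _)
        _ = t₂ * (c₀ * M ^ 2) := by ring
        _ ≤ t₂ * A := mul_le_mul_of_nonneg_left hAM ht₂pos.le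
    · exact (mul_le_of_le_one_left (NNReal.coe_nonneg _) hk1)
  have hBm : c₀ * k ^ 2 * m ^ 2 ≤ B := by
    calc c₀ * k ^ 2 * m ^ 2 = c₀ * (k * m) ^ 2 := by ring
      _ ≤ c₀ * (max (t₂ * A) ((normAbs (v.adicCompletion ↥(maximalRealSubfield L)) (p 2) : ℝ≥0) : ℝ)) ^ 2 := by
          refine mul_le_mul_of_nonneg_left (pow_le_pow_left₀ (mul_nonneg hkpos.le hm0) hkm 2) hc₀.le
      _ ≤ B := hBle
  -- conclude by the dichotomy `m ≤ 1` ∕ `1 ≤ m`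
  have hQ1 : (1 : ℝ) ≤ max 1 (max A B) := le_max_left _ _
  have hQB : B ≤ max 1 (max A B) := le_max_of_le_right (le_max_right _ _)
  rcases le_total m 1 with hm1 | hm1
  · rw [show max 1 m = 1 from max_eq_left hm1, one_pow, mul_one]
    exact (min_le_left _ _).trans hQ1
  · rw [show max 1 m = m from max_eq_right hm1]
    calc min 1 (c₀ * k ^ 2) * m ^ 2 ≤ c₀ * k ^ 2 * m ^ 2 := mul_le_mul_of_nonneg_right (min_le_right _ _) (sq_nonneg _)
      _ ≤ B := hBm
      _ ≤ _ := hQB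

/-! ## §4 Integrability of `Q_v^{−σ}` for `σ > 1` at a non-split bad place -/

variable [MeasurableSpace (v.adicCompletion ↥(maximalRealSubfield L))] [BorelSpace (v.adicCompletion ↥(maximalRealSubfield L))] (νv : Measure (v.adicCompletion ↥(maximalRealSubfield L))) [νv.IsAddHaarMeasure]

include hd in
/-- **`Q_v^{−σ}` IS INTEGRABLE FOR EVERY REAL `σ > 1` AT EVERY NON-SPLIT PLACE** (ramified, `v ∣ 2`, `δ` a non-unit allowed) — F3's letter `hT` ∕ (β)'s «every-v integrability» with
the sharp abscissa: `Q_v^{−σ} ≤ c'^{−σ}·𝒲^{−2σ}` (§3) and ★ (3-i) `integrable_inertCell_pi`. [cite: Langlands1971, §3] [cite: TateThesis1967, §3.3] -/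
theorem integrable_localHeight_rpow_neg_of_nonsplit (hw : IsCMField.complexConj L • w.1 = w.1) {σ : ℝ} (hσ : 1 < σ) :
    Integrable (fun p : Fin 3 → v.adicCompletion ↥(maximalRealSubfield L) =>
      (∏ w' : PlacesOver L v, max 1 (max ((normAbs (w'.1.adicCompletion L) (quadraticLocalEquiv L v (IsCMField.complexConj L) hcδ hδ (p 0, p 1) w') : ℝ≥0) : ℝ)
          ((normAbs (w'.1.adicCompletion L) ((toLocalRing L v (p 2) * algebraMap L (LocalRing L v) δ -
            toLocalRing L v 2⁻¹ * (quadraticLocalEquiv L v (IsCMField.complexConj L) hcδ hδ (p 0, p 1) *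
              conjLocal L (IsCMField.complexConj L) v (quadraticLocalEquiv L v (IsCMField.complexConj L) hcδ hδ (p 0, p 1)))) w') : ℝ≥0) : ℝ))) ^ (-σ)) (Measure.pi fun _ : Fin 3 => νv) := by
  haveI : Algebra.IsQuadraticExtension ↥(maximalRealSubfield L) L := IsCMField.isQuadraticExtension L
  haveI := secondCountableTopology_localField (v.adicCompletion ↥(maximalRealSubfield L))
  obtain ⟨c', hc', hdom⟩ := exists_pos_mul_weight_sq_le_localHeight L hcδ hδ hd v w hw
  refine ((integrable_inertCell_pi νv hσ).const_mul (c' ^ (-σ))).mono'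
    (continuous_localHeight_rpow L (IsCMField.complexConj L) hcδ hδ v σ).aestronglyMeasurable (Eventually.of_forall fun p => ?_)
  have hW1 : (1 : ℝ) ≤ (max 1 (max ((max ((normAbs (v.adicCompletion ↥(maximalRealSubfield L)) (p 0) : ℝ≥0) : ℝ) ((normAbs (v.adicCompletion ↥(maximalRealSubfield L)) (p 1) : ℝ≥0) : ℝ)) ^ 2) ((normAbs (v.adicCompletion ↥(maximalRealSubfield L)) (p 2) : ℝ≥0) : ℝ))) := le_max_left _ _
  have hW0 : (0 : ℝ) ≤ (max 1 (max ((max ((normAbs (v.adicCompletion ↥(maximalRealSubfield L)) (p 0) : ℝ≥0) : ℝ) ((normAbs (v.adicCompletion ↥(maximalRealSubfield L)) (p 1) : ℝ≥0) : ℝ)) ^ 2) ((normAbs (v.adicCompletion ↥(maximalRealSubfield L)) (p 2) : ℝ≥0) : ℝ))) := zero_le_one.trans hW1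
  have hpos : 0 < c' * (max 1 (max ((max ((normAbs (v.adicCompletion ↥(maximalRealSubfield L)) (p 0) : ℝ≥0) : ℝ) ((normAbs (v.adicCompletion ↥(maximalRealSubfield L)) (p 1) : ℝ≥0) : ℝ)) ^ 2) ((normAbs (v.adicCompletion ↥(maximalRealSubfield L)) (p 2) : ℝ≥0) : ℝ))) ^ 2 := mul_pos hc' (by positivity)
  have hQ := hdom p
  rw [Real.norm_of_nonneg (Real.rpow_nonneg (hpos.le.trans hQ) _)]
  calc _ ≤ (c' * (max 1 (max ((max ((normAbs (v.adicCompletion ↥(maximalRealSubfield L)) (p 0) : ℝ≥0) : ℝ) ((normAbs (v.adicCompletion ↥(maximalRealSubfield L)) (p 1) : ℝ≥0) : ℝ)) ^ 2) ((normAbs (v.adicCompletion ↥(maximalRealSubfield L)) (p 2) : ℝ≥0) : ℝ))) ^ 2) ^ (-σ) := Real.rpow_le_rpow_of_nonpos hpos hQ (by linarith)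
    _ = c' ^ (-σ) * (max 1 (max ((max ((normAbs (v.adicCompletion ↥(maximalRealSubfield L)) (p 0) : ℝ≥0) : ℝ) ((normAbs (v.adicCompletion ↥(maximalRealSubfield L)) (p 1) : ℝ≥0) : ℝ)) ^ 2) ((normAbs (v.adicCompletion ↥(maximalRealSubfield L)) (p 2) : ℝ≥0) : ℝ))) ^ (-(2 * σ)) := by
        rw [Real.mul_rpow hc'.le (by positivity), show (-(2 * σ) : ℝ) = ((2 : ℕ) : ℝ) * (-σ) by push_cast; ring,
          Real.rpow_natCast_mul hW0]

end Summit.HodgeConjecture.HodgeConjecture.Cruxes.H413.K2E1IntertwiningLocalFactorBadPlaceU3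

end
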